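import Summits.BirchSwinnertonDyer.BirchSwinnertonDyer.Theses.Squeeze
import Summits.BirchSwinnertonDyer.BirchSwinnertonDyer.Theses.LeadingTerm
import Summits.BirchSwinnertonDyer.BirchSwinnertonDyer.Theorems.LeadingTermSqueezeUBR2ThreeCells
import Summits.BirchSwinnertonDyer.BirchSwinnertonDyer.Theorems.SelmerRankShaCorank
import Literature.NumberTheory.EllipticCurves.BSDSelmer
import Literature.NumberTheory.EllipticCurves.SelmerCorankHolds
import Literature.NumberTheory.EllipticCurves.BSDSha
import Literature.NumberTheory.EllipticCurves.KatoRankBound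
import HarnessLib

/-!
# BirchSwinnertonDyer — crux `SqueezeUB` / `SqueezeUBR2` (stmt-BirchSwinnertonDyer-0145),
# line `Sketch` (skeleton v3), stub PAR: the residual input, made explicit

Stub PAR of the three-cell cut GZK ∧ PAR ∧ UBE4 of the crux "no excess rank"
(`squeezeUB_iff_threeCells`, p132393) is, on globally minimal models,

  `∀ W, [W.IsElliptic] → [W.IsGloballyMinimal] → 2 ≤ r_an(W) → rank(W) % 2 ≠ r_an(W) % 2 → rank(W) ≤ r_an(W)`,

"no elliptic curve over `ℚ` has an excess `rank − r_an` of ODD size" (cells `(rank, r_an) = (3,2),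
(4,3), (5,2), (5,4), …`). It is OPEN: it follows from Mordell–Weil parity `Even rank ↔ Even r_an`
(route Squeeze's crux `SqueezeParity`, stmt-0146, open; landed `squeezeUB_par_of_squeezeParity`)
and has no proof short of it. What IS a theorem in print is parity one level up, for the
`p^∞`-Selmer CORANK: `corank_{ℤ_p} Sel_{p^∞}(E/ℚ) ≡ ord_{s=1} L(E,s) (mod 2)` for every `E/ℚ`
and every prime `p` (Dokchitser–Dokchitser, Ann. of Math. 172 (2010), Thm. 1.4; tree named fact
bsd.S19 `Literature.NumberTheory.EllipticCurves.selmerCorank_mod_two_eq`, undischarged), and the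
corank identity `corank Sel_{p^∞} = rank + corank_{ℤ_p} Ш[p^∞]` is a tree THEOREM
(`WeierstrassCurve.selmerCorank_eq_mordellWeilRank_add_holds`; Greenberg, LNM 1716, §1). Hence,
curve by curve and prime by prime, `p`-parity reaches the Mordell–Weil rank EXACTLY through the
parity of `corank_{ℤ_p} Ш(E/ℚ)[p^∞]` ("the number of copies of `ℚ_p/ℤ_p` in `Ш`", loc. cit. §1).
This file does NOT prove the stub; it records, sorry-free and CONDITIONALLY, what it costs:

* `squeezeUB_parityMW_iff_even_shaCorank` (one curve, one prime): given `p`-parity at `(E, p)`,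
  `rank ≡ r_an (mod 2) ↔ corank_{ℤ_p} Ш[p^∞]` even. Unconditional (the corank identity is proved).
* `squeezeUB_par_of_pParity_of_evenShaCorank` (registered sub-goal; the WEAKEST typed sufficient
  condition of this kind): PAR holds as soon as every would-be excess curve (`2 ≤ r_an < rank`,
  globally minimal) has ONE prime `p` with `p`-parity at `(E, p)` and `corank_{ℤ_p} Ш[p^∞]` even.
* `squeezeUB_par_iff_evenShaCorank_of_pParity`: granting `p`-parity everywhere, PAR is EQUIVALENT
  to "every would-be excess curve has even `Ш[p^∞]`-corank at every prime" — the exact residue.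
* Corollaries: `squeezeUB_par_of_pParity_of_finiteShaPrimary` (`Ш[p^∞]` finite at one prime, via
  the tree theorem `Literature.BSD.shaCorank_eq_zero_of_finite`), `squeezeUB_par_of_pParity_of_shaFinite`
  (the Shafarevich–Tate conjecture `ShaFiniteConjecture`, bsd.S02), `squeezeUB_par_of_fact_of_shaFinite`
  (same with `p`-parity plugged BY NAME as the ∀-closure of bsd.S19), and the route-internal
  `squeezeUB_par_of_pinchPrime` (inside route LeadingTerm: Kato's corank bound Thm. 18.4 +
  `p`-parity + the route's crux `PinchPrime`, one line over the landed
  `squeezeUB_parity_of_pinchPrime`).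
* `squeezeUB_par_iff_excess_parity`: PAR ⇔ "every excess is even" (pure logic).

Everything here is glue (bookkeeping in `ℕ` modulo `2`); the named facts enter as hypotheses,
never as vendored statements. Nothing closes the crux or the stub.

References: Dokchitser–Dokchitser, Ann. of Math. 172 (2010), §1 (Conj. 1.1, 1.2) and Thm. 1.4;
Greenberg, LNM 1716 (1999), §1; Kato, Astérisque 295 (2004), Thm. 18.4; Tate, Invent. Math. 23
(1974), §1 Conj. 1.
-/

-- D-0017: single-problem summit, so `Summit.BirchSwinnertonDyer.BirchSwinnertonDyer.…` repeats a
-- namespace BY DESIGN.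
set_option linter.dupNamespace false

namespace Summit.BirchSwinnertonDyer.BirchSwinnertonDyer.Theorems

open scoped MatrixGroups ModularForm
open CongruenceSubgroup Literature.NumberTheory.EllipticCurves
  Literature.NumberTheory.EllipticCurves.ModularForms WeierstrassCurve
open Summit.BirchSwinnertonDyer.BirchSwinnertonDyer.Theses.Squeeze (SqueezeUB SqueezeParity)
open Summit.BirchSwinnertonDyer.BirchSwinnertonDyer.Theses.LeadingTerm (SqueezeUBR2 PinchPrime)

/-! ### One curve, one prime: `p`-parity reaches the rank exactly through `corank Ш[p^∞] (mod 2)` -/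

/-- **Mordell–Weil parity versus `p`-parity, at one curve and one prime.** For an elliptic `E/ℚ`
(model `W`) and a prime `p` at which `p`-parity holds (`hpp`, the body of the tree fact bsd.S19
`selmerCorank_mod_two_eq W p`: `corank_{ℤ_p} Sel_{p^∞}(E/ℚ) ≡ ord_{s=1} L(E,s) (mod 2)`,
Dokchitser–Dokchitser 2010, Thm. 1.4), `rank E(ℚ) ≡ ord_{s=1} L(E,s) (mod 2)` holds iff
`corank_{ℤ_p} Ш(E/ℚ)[p^∞]` is even — by the PROVED corank identity
`corank Sel_{p^∞} = rank + corank Ш[p^∞]` (`selmerCorank_eq_mordellWeilRank_add_holds`; "the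
`p^∞`-Selmer rank, that is the Mordell–Weil rank plus the number of copies of `ℚ_p/ℤ_p` in `Ш`").
[cite: DokchitserDokchitserAnnals2010, §1 (Conj. 1.1, 1.2) and Thm. 1.4] -/
theorem squeezeUB_parityMW_iff_even_shaCorank (W : WeierstrassCurve ℚ) [W.IsElliptic] (p : ℕ)
    [Fact p.Prime] (hpp : W.selmerCorank p % 2 = W.analyticRank % 2) :
    W.mordellWeilRank % 2 = W.analyticRank % 2 ↔ Even (W.shaCorank p) := by
  have hid : W.selmerCorank p = W.mordellWeilRank + W.shaCorank p :=
    W.selmerCorank_eq_mordellWeilRank_add_holds p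
  rw [Nat.even_iff]
  omega

/-- At a prime of `p`-parity, an even `corank_{ℤ_p} Ш(E/ℚ)[p^∞]` (in particular a finite
`Ш[p^∞]`) gives Mordell–Weil parity `rank ≡ r_an (mod 2)` for that curve.
[cite: DokchitserDokchitserAnnals2010, §1 and Thm. 1.4] -/
theorem squeezeUB_parityMW_of_pParity_of_even_shaCorank (W : WeierstrassCurve ℚ) [W.IsElliptic]
    (p : ℕ) [Fact p.Prime] (hpp : W.selmerCorank p % 2 = W.analyticRank % 2)
    (hev : Even (W.shaCorank p)) : W.mordellWeilRank % 2 = W.analyticRank % 2 :=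
  (squeezeUB_parityMW_iff_even_shaCorank W p hpp).mpr hev

/-! ### The registered sub-goal: PAR from `p`-parity and even `Ш[p^∞]`-corank at ONE prime -/

/-- **Stub PAR from its weakest typed input** (registered sub-goal of line `Sketch`, v3). If every
would-be excess curve — elliptic `E/ℚ`, globally minimal `W`, `2 ≤ ord_{s=1} L(E,s) < rank E(ℚ)` —
has ONE prime `p` at which `p`-parity holds (`corank Sel_{p^∞} ≡ r_an (mod 2)`, Dokchitser–
Dokchitser 2010 Thm. 1.4, a theorem in print for all `p`) and `corank_{ℤ_p} Ш(E/ℚ)[p^∞]` is even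
(open; `0` if `Ш[p^∞]` is finite), then no curve has an excess of odd size: for such a curve
`rank ≡ corank Sel_{p^∞} − corank Ш[p^∞] ≡ r_an (mod 2)`, contradicting the parity mismatch.
CONDITIONAL on that hypothesis; the corank identity used is a tree theorem.
[cite: DokchitserDokchitserAnnals2010, §1 (Conj. 1.1, 1.2) and Thm. 1.4] -/
theorem squeezeUB_par_of_pParity_of_evenShaCorank :
    (∀ (W : WeierstrassCurve ℚ) [W.IsElliptic] [W.IsGloballyMinimal],
        2 ≤ W.analyticRank → W.analyticRank < W.mordellWeilRank →
          ∃ p, ∃ (_ : Fact (Nat.Prime p)),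
            W.selmerCorank p % 2 = W.analyticRank % 2 ∧ Even (W.shaCorank p)) →
      ∀ (W : WeierstrassCurve ℚ) [W.IsElliptic] [W.IsGloballyMinimal],
        2 ≤ W.analyticRank → W.mordellWeilRank % 2 ≠ W.analyticRank % 2 →
          W.mordellWeilRank ≤ W.analyticRank := by
  intro h W _ _ h2 hne
  by_contra hlt
  obtain ⟨p, hp, hpp, hev⟩ := h W h2 (Nat.lt_of_not_le hlt)
  exact hne ((squeezeUB_parityMW_iff_even_shaCorank W p hpp).mpr hev)

/-! ### Exactness: granting `p`-parity, PAR is precisely "excess curves have even `Ш[p^∞]`-corank" -/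

/-- **PAR ⇔ every excess is even** (pure logic): on globally minimal models with `2 ≤ r_an`,
"parity mismatch ⇒ `rank ≤ r_an`" says exactly that every would-be excess curve (`r_an < rank`)
has `rank ≡ r_an (mod 2)`. [folklore] -/
theorem squeezeUB_par_iff_excess_parity :
    (∀ (W : WeierstrassCurve ℚ) [W.IsElliptic] [W.IsGloballyMinimal],
        2 ≤ W.analyticRank → W.mordellWeilRank % 2 ≠ W.analyticRank % 2 →
          W.mordellWeilRank ≤ W.analyticRank) ↔
      ∀ (W : WeierstrassCurve ℚ) [W.IsElliptic] [W.IsGloballyMinimal],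
        2 ≤ W.analyticRank → W.analyticRank < W.mordellWeilRank →
          W.mordellWeilRank % 2 = W.analyticRank % 2 := by
  constructor
  · intro h W _ _ h2 hlt
    by_contra hne
    exact absurd (h W h2 hne) (Nat.not_le.mpr hlt)
  · intro h W _ _ h2 hne
    by_contra hlt
    exact hne (h W h2 (Nat.lt_of_not_le hlt))

/-- **The exact residue of PAR under `p`-parity.** Granting `p`-parity on globally minimal
models at every prime (`hpp`, the body of bsd.S19 `selmerCorank_mod_two_eq`, Dokchitser–
Dokchitser 2010 Thm. 1.4), the PAR-cell is EQUIVALENT to: every would-be excess curve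
(`2 ≤ r_an < rank`) has even `corank_{ℤ_p} Ш(E/ℚ)[p^∞]` at every prime `p`. (`→`: PAR forces
matching parity on excess curves, and `squeezeUB_parityMW_iff_even_shaCorank`; `←`: the
registered sub-goal at `p = 2`.) So, net of the theorem in print, stub PAR is exactly a statement
about the divisible part of `Ш` of excess curves. CONDITIONAL on `hpp`.
[cite: DokchitserDokchitserAnnals2010, §1 (Conj. 1.1, 1.2) and Thm. 1.4] -/
theorem squeezeUB_par_iff_evenShaCorank_of_pParity
    (hpp : ∀ (W : WeierstrassCurve ℚ) [W.IsElliptic] [W.IsGloballyMinimal] (p : ℕ) [Fact p.Prime],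
      W.selmerCorank p % 2 = W.analyticRank % 2) :
    (∀ (W : WeierstrassCurve ℚ) [W.IsElliptic] [W.IsGloballyMinimal],
        2 ≤ W.analyticRank → W.mordellWeilRank % 2 ≠ W.analyticRank % 2 →
          W.mordellWeilRank ≤ W.analyticRank) ↔
      ∀ (W : WeierstrassCurve ℚ) [W.IsElliptic] [W.IsGloballyMinimal] (p : ℕ) [Fact p.Prime],
        2 ≤ W.analyticRank → W.analyticRank < W.mordellWeilRank → Even (W.shaCorank p) := by
  constructor
  · intro hPAR W _ _ p _ h2 hlt
    exact (squeezeUB_parityMW_iff_even_shaCorank W p (hpp W p)).mp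
      (squeezeUB_par_iff_excess_parity.mp hPAR W h2 hlt)
  · intro hev
    exact squeezeUB_par_of_pParity_of_evenShaCorank
      (fun W _ _ h2 hlt => ⟨2, Nat.fact_prime_two, hpp W 2, hev W 2 h2 hlt⟩)

/-! ### Corollaries: finite `Ш[p^∞]` at one prime; the Shafarevich–Tate conjecture -/

/-- **PAR from `p`-parity and a finite `Ш[p^∞]` at ONE prime** of every would-be excess curve: a
finite `p`-primary `Ш` has `ℤ_p`-corank `0` (tree theorem `Literature.BSD.shaCorank_eq_zero_of_finite`,
Greenberg 1999 §1), which is even. This is the classical route "`p`-parity + `Ш(E/ℚ)[p^∞]`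
finite for some `p` ⇒ the parity conjecture for `E`". CONDITIONAL on the hypothesis.
[cite: DokchitserDokchitserAnnals2010, §1 and Thm. 1.4] -/
theorem squeezeUB_par_of_pParity_of_finiteShaPrimary :
    (∀ (W : WeierstrassCurve ℚ) [W.IsElliptic] [W.IsGloballyMinimal],
        2 ≤ W.analyticRank → W.analyticRank < W.mordellWeilRank →
          ∃ p, ∃ (_ : Fact (Nat.Prime p)), W.selmerCorank p % 2 = W.analyticRank % 2 ∧
            Finite (AddCommGroup.primaryComponent W.sha p)) →
      ∀ (W : WeierstrassCurve ℚ) [W.IsElliptic] [W.IsGloballyMinimal],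
        2 ≤ W.analyticRank → W.mordellWeilRank % 2 ≠ W.analyticRank % 2 →
          W.mordellWeilRank ≤ W.analyticRank := by
  intro h
  refine squeezeUB_par_of_pParity_of_evenShaCorank (fun W _ _ h2 hlt => ?_)
  obtain ⟨p, hp, hpp, hfin⟩ := h W h2 hlt
  refine ⟨p, hp, hpp, ?_⟩
  rw [Literature.BSD.shaCorank_eq_zero_of_finite W p hfin]
  exact Even.zero

/-- **PAR from `p`-parity and the Shafarevich–Tate conjecture.** Granting `p`-parity on globally
minimal models (body of bsd.S19, Dokchitser–Dokchitser 2010 Thm. 1.4; used at `p = 2` only) and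
the finiteness of `Ш(E/ℚ)` for every elliptic `E/ℚ` (the tree conjecture bsd.S02
`ShaFiniteConjecture`, Tate 1974 Conj. 1), the PAR-cell holds: `Ш` finite ⇒ `Ш[2^∞]` finite ⇒
corank `0`. CONDITIONAL on both hypotheses (the second is conjectural).
[cite: Tate1974, §1 Conj. 1] -/
theorem squeezeUB_par_of_pParity_of_shaFinite :
    (∀ (W : WeierstrassCurve ℚ) [W.IsElliptic] [W.IsGloballyMinimal] (p : ℕ) [Fact p.Prime],
        W.selmerCorank p % 2 = W.analyticRank % 2) →
      ShaFiniteConjecture →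
        ∀ (W : WeierstrassCurve ℚ) [W.IsElliptic] [W.IsGloballyMinimal],
          2 ≤ W.analyticRank → W.mordellWeilRank % 2 ≠ W.analyticRank % 2 →
            W.mordellWeilRank ≤ W.analyticRank := by
  intro hpp hSha
  refine squeezeUB_par_of_pParity_of_finiteShaPrimary (fun W _ _ _ _ => ?_)
  haveI : Finite W.sha := hSha W ‹_›
  exact ⟨2, Nat.fact_prime_two, hpp W 2, inferInstance⟩

/-! ### The `p`-parity input by name (bsd.S19), and the route-internal form (LeadingTerm) -/

/-- The inlined `p`-parity hypothesis of this file from the ∀-closure of the NAMED fact bsd.S19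
`Literature.NumberTheory.EllipticCurves.selmerCorank_mod_two_eq` ("Conjecture 1.2 holds for all
`E/ℚ` and all primes `p`", Dokchitser–Dokchitser 2010, Thm. 1.4; UNPROVED in the tree), by
restriction to globally minimal models. [cite: DokchitserDokchitserAnnals2010, Thm. 1.4] -/
theorem squeezeUB_pParity_of_fact
    (h : ∀ (W : WeierstrassCurve ℚ) [W.IsElliptic] (p : ℕ) [Fact p.Prime],
      selmerCorank_mod_two_eq W p) :
    ∀ (W : WeierstrassCurve ℚ) [W.IsElliptic] [W.IsGloballyMinimal] (p : ℕ) [Fact p.Prime],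
      W.selmerCorank p % 2 = W.analyticRank % 2 :=
  fun W _ _ p _ => h W p

/-- **PAR from the two named statements**: the `p`-parity theorem bsd.S19 (∀-closure of
`selmerCorank_mod_two_eq`, Dokchitser–Dokchitser 2010 Thm. 1.4, literature debt) and the
Shafarevich–Tate conjecture bsd.S02 (`ShaFiniteConjecture`). CONDITIONAL on both.
[cite: DokchitserDokchitserAnnals2010, Thm. 1.4] -/
theorem squeezeUB_par_of_fact_of_shaFinite :
    (∀ (W : WeierstrassCurve ℚ) [W.IsElliptic] (p : ℕ) [Fact p.Prime],
        selmerCorank_mod_two_eq W p) →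
      ShaFiniteConjecture →
        ∀ (W : WeierstrassCurve ℚ) [W.IsElliptic] [W.IsGloballyMinimal],
          2 ≤ W.analyticRank → W.mordellWeilRank % 2 ≠ W.analyticRank % 2 →
            W.mordellWeilRank ≤ W.analyticRank :=
  fun h hSha => squeezeUB_par_of_pParity_of_shaFinite (squeezeUB_pParity_of_fact h) hSha

/-- **Route-internal form (LeadingTerm).** Inside route LeadingTerm, whose deciding theorem
already carries the crux `PinchPrime` (stmt-16218: a good ordinary `p ≥ 5` and a newform `f` with
`ord_{T=0} L_p(f, α_p, T) = rank`), the PAR-cell follows from the ∀-closure of Kato's corank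
bound (tree fact `kato_selmerCorank_le_order_padicLFunction`, Kato 2004 Thm. 18.4), `p`-parity
(body of bsd.S19) and `PinchPrime`: these give Mordell–Weil parity on globally minimal models
(landed `squeezeUB_parity_of_pinchPrime`: at the pinch prime `corank ≤ ord_T L_p = rank ≤ corank`),
and parity empties the PAR-cell (`squeezeUB_par_of_parity`). CONDITIONAL on the two facts and
the route item. [cite: Kato2004, Thm 18.4] -/
theorem squeezeUB_par_of_pinchPrime
    (hK : ∀ (W : WeierstrassCurve ℚ) [W.IsElliptic] [W.IsGloballyMinimal] (p : ℕ) [Fact p.Prime]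
      {N : ℕ} [NeZero N] {f : CuspForm (Gamma0 N) 2},
      kato_selmerCorank_le_order_padicLFunction W p (f := f))
    (hpp : ∀ (W : WeierstrassCurve ℚ) [W.IsElliptic] [W.IsGloballyMinimal] (p : ℕ) [Fact p.Prime],
      W.selmerCorank p % 2 = W.analyticRank % 2)
    (hP : PinchPrime) :
    ∀ (W : WeierstrassCurve ℚ) [W.IsElliptic] [W.IsGloballyMinimal],
      2 ≤ W.analyticRank → W.mordellWeilRank % 2 ≠ W.analyticRank % 2 →
        W.mordellWeilRank ≤ W.analyticRank :=
  squeezeUB_par_of_parity (squeezeUB_parity_of_pinchPrime hK hpp hP)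

end Summit.BirchSwinnertonDyer.BirchSwinnertonDyer.Theorems
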